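import Summits.BirchSwinnertonDyer.BirchSwinnertonDyer.Theorems.AdditiveBranchIMCGordTwoTwistedWanDefs
import Summits.BirchSwinnertonDyer.BirchSwinnertonDyer.Theorems.AdditiveBranchIMCGordTwoRankZeroOffCaseOneFieldSupplyR0Partner
import Summits.BirchSwinnertonDyer.BirchSwinnertonDyer.Theorems.AdditiveKolyvaginRoadGammaAvatarLocusSlim
import Summits.BirchSwinnertonDyer.Rank1Residual.P2.SplitBadTwistTypes
import Literature.NumberTheory.EllipticCurves.PAdicLFunctionQuadraticTwistBirchSharedPrimesProofs
import Literature.NumberTheory.DiophantineGeometry.ConductorAdditiveProofs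
import Literature.NumberTheory.EllipticCurves.SzpiroLocalDataProofs
import Literature.NumberTheory.EllipticCurves.RootNumberProofs
import HarnessLib

/-!
# The twisted Wan road (crux 19357, line `three_field_road`, design D2 of FieldTwoTwisted): LOCAL TRANSPORT
# between a (G-ord, `e = 2`) curve `E` and its good-ordinary partner `V` (`E ≅ V^{(p*)}`, `N_E = N_V p²`)

Theorems only (LEAD g15). The master root-number engine
`TwistRootNumberTwisted.rootNumber_quadraticTwist_eq_of_potMult` (p798928) is applied in design D2 to the PARTNER `V` of
`ThreeFieldRoadSupply.exists_goodOrd_partner_rootNumber`, not to `E`; its hypotheses about `V` (twist type at the odd additive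
primes, not additive at `2`, additive and potentially multiplicative at the twisted Wan prime `q`, good at the primes of the
twist parameter) are read off `E` here, prime by prime, through the conductor exponent:
`f_ℓ(E) = f_ℓ(V)` and `f_ℓ(E^{(e)}) = f_ℓ(V^{(e)})` for every prime `ℓ ≠ p` and every `e ≠ 0` (`p* ` is an `ℓ`-adic unit,
`factorization_conductorNorm_quadraticTwist_eq_of_not_dvd`), and `f_ℓ ≥ 2 ⟺` additive, `f_ℓ = 1 ⟺` multiplicative.

* `factorization_conductorNorm_eq_of_partner`, `hasAdditiveReductionAt_iff_of_partner`;
* `factorization_conductorNorm_quadraticTwist_eq_of_partner`, `hasMultiplicativeReductionAtPrime_quadraticTwist_iff_of_partner`,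
  `hasAdditiveReductionAt_quadraticTwist_iff_of_partner`;
* `twistType_of_partner` (the engine's `htt` for `V` from the one for `E`), `hasGoodReductionAt_of_partner_of_not_dvd`,
  `partner_local_data` (at the twisted Wan prime `q` and at `2`).

BSD is proved for no curve. References: [SilvermanAEC2009] VII.5, X.5 Cor. 5.4, App. C §16; [SilvermanATAEC1994] IV.10.2.
-/

set_option linter.dupNamespace false
set_option autoImplicit false

noncomputable section

open scoped Classical

open WeierstrassCurve IsDedekindDomain NumberField Rat.HeightOneSpectrum
  Literature.NumberTheory.EllipticCurves Literature.NumberTheory.EllipticCurves.ModularForms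
  Summit.BirchSwinnertonDyer.Rank1Residual
  Summit.BirchSwinnertonDyer.BirchSwinnertonDyer.Theorems

namespace Summit.BirchSwinnertonDyer.BirchSwinnertonDyer.Theorems.TwistedWanRoad

open Summit.BirchSwinnertonDyer.BirchSwinnertonDyer.Theorems.AdditiveKoly.RamifiedHabitat (pStar_emod_four eq_of_prime_dvd_pStar)

variable (V W : WeierstrassCurve ℚ) [V.IsElliptic] [W.IsElliptic] (p : ℕ) [hp : Fact p.Prime]

/-! ### §1 Untwisted: `f_ℓ(E) = f_ℓ(V)` for `ℓ ≠ p` -/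

omit [W.IsElliptic] in
/-- If `N_E = N_V · p²` then `E` and `V` have the same conductor exponent at every prime `ℓ ≠ p`. [folklore] -/
theorem factorization_conductorNorm_eq_of_partner (hNWV : W.conductorNorm ℤ = V.conductorNorm ℤ * p ^ 2)
    {ℓ : ℕ} (hℓp : ℓ ≠ p) :
    (W.conductorNorm ℤ).factorization ℓ = (V.conductorNorm ℤ).factorization ℓ := by
  have hV0 : V.conductorNorm ℤ ≠ 0 := (V.conductorNorm_pos_holds).ne'
  have hp0 : p ^ 2 ≠ 0 := pow_ne_zero _ hp.out.ne_zero
  rw [hNWV, Nat.factorization_mul hV0 hp0, Finsupp.add_apply, Nat.factorization_pow, Finsupp.smul_apply,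
    hp.out.factorization, Finsupp.single_apply, if_neg (Ne.symm hℓp), smul_zero, add_zero]

/-- `E` is additive at a prime `ℓ ≠ p` iff its partner `V` is (`f_ℓ ≥ 2 ⟺` additive, `f_ℓ(E) = f_ℓ(V)`).
[cite: SilvermanATAEC1994, IV.10.2] -/
theorem hasAdditiveReductionAt_iff_of_partner (hNWV : W.conductorNorm ℤ = V.conductorNorm ℤ * p ^ 2)
    (r : Nat.Primes) (hrp : (r : ℕ) ≠ p) :
    W.HasAdditiveReductionAt ((primesEquiv (R := ℤ)).symm r) ↔ V.HasAdditiveReductionAt ((primesEquiv (R := ℤ)).symm r) := by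
  set v : HeightOneSpectrum ℤ := (primesEquiv (R := ℤ)).symm r with hv
  rw [← two_le_conductorExponent_iff_holds v W, ← two_le_conductorExponent_iff_holds v V, hv,
    ← factorization_conductorNorm_primesEquiv_symm W r, ← factorization_conductorNorm_primesEquiv_symm V r,
    factorization_conductorNorm_eq_of_partner V W p hNWV hrp]

omit [W.IsElliptic] hp in
/-- A prime `ℓ ∤ N_E` is a good prime of the partner `V` (`N_V ∣ N_E`). [cite: SilvermanAEC2009, VII.5 Prop. 5.1] -/
theorem hasGoodReductionAt_of_partner_of_not_dvd (hNWV : W.conductorNorm ℤ = V.conductorNorm ℤ * p ^ 2)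
    (r : Nat.Primes) (hr : ¬ (r : ℕ) ∣ W.conductorNorm ℤ) :
    V.HasGoodReductionAt ((primesEquiv (R := ℤ)).symm r) := by
  haveI := Fact.mk r.2
  have hrV : ¬ (r : ℕ) ∣ V.conductorNorm ℤ := fun h ↦ hr (hNWV ▸ dvd_mul_of_dvd_left h _)
  have hg : V.HasGoodReductionAtPrime r := by
    by_contra hng
    exact hrV ((V.dvd_conductorNorm_iff_not_hasGoodReductionAtPrime r).mpr hng)
  exact ((hasGoodReductionAtPrime_iff_hasGoodReductionAt_holds V) r).mp hg

/-- The partner `V` (with `p ∤ N_V`) is not additive at `p`. [folklore] -/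
theorem not_hasAdditiveReductionAt_partner_at_p (hpN : ¬ p ∣ V.conductorNorm ℤ) :
    ¬ V.HasAdditiveReductionAt ((primesEquiv (R := ℤ)).symm ⟨p, hp.out⟩) := by
  intro hadd
  have h2 := (two_le_conductorExponent_iff_holds ((primesEquiv (R := ℤ)).symm ⟨p, hp.out⟩) V).mpr hadd
  rw [← factorization_conductorNorm_primesEquiv_symm V ⟨p, hp.out⟩] at h2
  have h0 : (V.conductorNorm ℤ).factorization p = 0 := Nat.factorization_eq_zero_of_not_dvd hpN
  simp only at h2
  omega

/-! ### §2 Twisted: `f_ℓ(E^{(e)}) = f_ℓ(V^{(e)})` for `ℓ ≠ p` -/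

omit [W.IsElliptic] in
/-- For `C • V = E^{(p*)}` (so `E ≅ V^{(p*)}`), every `e ≠ 0` and every prime `ℓ ≠ p`: `f_ℓ(E^{(e)}) = f_ℓ(V^{(e)})`
(`E^{(e)} ≅ V^{(p* e)} = (V^{(e)})^{(p*)}` and `p*` is an `ℓ`-adic unit `≡ 1 (mod 4)`).
[cite: SilvermanAEC2009, X.5 Cor. 5.4 and App. C §16] [cite: SilvermanATAEC1994, IV.10.2] -/
theorem factorization_conductorNorm_quadraticTwist_eq_of_partner {CV : VariableChange ℚ}
    (hCV : CV • V = W.quadraticTwist ((-1 : ℚ) ^ (p / 2) * p)) (hp2 : p ≠ 2) {e : ℤ} (he : e ≠ 0)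
    (r : Nat.Primes) (hrp : (r : ℕ) ≠ p)
    [(W.quadraticTwist (e : ℚ)).IsElliptic] [(V.quadraticTwist (e : ℚ)).IsElliptic] :
    ((W.quadraticTwist (e : ℚ)).conductorNorm ℤ).factorization r =
      ((V.quadraticTwist (e : ℚ)).conductorNorm ℤ).factorization r := by
  set ps : ℤ := (-1 : ℤ) ^ (p / 2) * p with hps
  have hpsQ : ((ps : ℤ) : ℚ) = (-1 : ℚ) ^ (p / 2) * p := by rw [hps]; push_cast; ring
  have hps0Q : ((ps : ℤ) : ℚ) ≠ 0 := by rw [hpsQ]; exact Additive.pStar_ne_zero p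
  have heQ : ((e : ℤ) : ℚ) ≠ 0 := by exact_mod_cast he
  rw [← hpsQ] at hCV
  -- `C₁ • V^{(p* e)} = E^{(p* · p* e)}`
  obtain ⟨C₁, hC₁⟩ :=
    P2.SplitBadTwistTypes.exists_smul_quadraticTwist_eq_of_smul_eq_quadraticTwist hCV ((ps : ℚ) * e)
  have hsq : (ps : ℚ) * ((ps : ℚ) * e) = (e : ℚ) * (ps : ℚ) ^ 2 := by ring
  rw [hsq] at hC₁
  -- `C₂ • E^{(e p*²)} = E^{(e)}`
  obtain ⟨C₂, hC₂⟩ := P2.SplitBadTwistTypes.exists_smul_quadraticTwist_mul_sq_eq W (e : ℚ) hps0Q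
  have key : (C₂ * C₁) • V.quadraticTwist ((ps : ℚ) * e) = W.quadraticTwist (e : ℚ) := by
    rw [mul_smul, hC₁, hC₂]
  -- `V^{(p* e)} = (V^{(e)})^{(p*)}`
  have htw : V.quadraticTwist ((ps : ℚ) * e) = (V.quadraticTwist (e : ℚ)).quadraticTwist ((ps : ℤ) : ℚ) := by
    rw [quadraticTwist_quadraticTwist, mul_comm]
  haveI : ((V.quadraticTwist (e : ℚ)).quadraticTwist ((ps : ℤ) : ℚ)).IsElliptic :=
    (V.quadraticTwist (e : ℚ)).isElliptic_quadraticTwist hps0Q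
  haveI : (V.quadraticTwist ((ps : ℚ) * e)).IsElliptic := V.isElliptic_quadraticTwist (mul_ne_zero hps0Q heQ)
  have hN : (W.quadraticTwist (e : ℚ)).conductorNorm ℤ =
      ((V.quadraticTwist (e : ℚ)).quadraticTwist ((ps : ℤ) : ℚ)).conductorNorm ℤ := by
    rw [← key, conductorNorm_smul_rat, htw]
  set v : HeightOneSpectrum ℤ := (primesEquiv (R := ℤ)).symm r with hv
  have hgen : natGenerator v = r := Literature.NumberTheory.EllipticCurves.Rat.natGenerator_primesEquiv_symm r
  have hvd : ¬ ((natGenerator v : ℕ) : ℤ) ∣ ps := by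
    rw [hgen]
    intro hd
    exact hrp (eq_of_prime_dvd_pStar (p := p) r.2 hd)
  have h := (V.quadraticTwist (e : ℚ)).factorization_conductorNorm_quadraticTwist_eq_of_not_dvd
    (pStar_emod_four (p := p) hp2) v hvd
  rw [hgen] at h
  rw [hN]
  exact h

/-- For `C • V = E^{(p*)}`, `e ≠ 0` and a prime `ℓ ≠ p`: `E^{(e)}` is multiplicative at `ℓ` iff `V^{(e)}` is
(`f_ℓ = 1 ⟺` multiplicative). [cite: SilvermanATAEC1994, IV.10.2 (b)] -/
theorem hasMultiplicativeReductionAtPrime_quadraticTwist_iff_of_partner {CV : VariableChange ℚ}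
    (hCV : CV • V = W.quadraticTwist ((-1 : ℚ) ^ (p / 2) * p)) (hp2 : p ≠ 2) {e : ℤ} (he : e ≠ 0)
    {ℓ : ℕ} [hℓ : Fact ℓ.Prime] (hℓp : ℓ ≠ p) :
    (W.quadraticTwist (e : ℚ)).HasMultiplicativeReductionAtPrime ℓ ↔
      (V.quadraticTwist (e : ℚ)).HasMultiplicativeReductionAtPrime ℓ := by
  have heQ : ((e : ℤ) : ℚ) ≠ 0 := by exact_mod_cast he
  haveI := W.isElliptic_quadraticTwist heQ
  haveI := V.isElliptic_quadraticTwist heQ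
  rw [AdditiveKoly.hasMultiplicativeReductionAtPrime_iff_factorization_conductorNorm_eq_one,
    AdditiveKoly.hasMultiplicativeReductionAtPrime_iff_factorization_conductorNorm_eq_one,
    factorization_conductorNorm_quadraticTwist_eq_of_partner V W p hCV hp2 he ⟨ℓ, hℓ.out⟩ hℓp]

/-- For `C • V = E^{(p*)}`, `e ≠ 0` and a prime `ℓ ≠ p`: `E^{(e)}` is additive at `ℓ` iff `V^{(e)}` is
(`f_ℓ ≥ 2 ⟺` additive). [cite: SilvermanATAEC1994, IV.10.2] -/
theorem hasAdditiveReductionAt_quadraticTwist_iff_of_partner {CV : VariableChange ℚ}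
    (hCV : CV • V = W.quadraticTwist ((-1 : ℚ) ^ (p / 2) * p)) (hp2 : p ≠ 2) {e : ℤ} (he : e ≠ 0)
    (r : Nat.Primes) (hrp : (r : ℕ) ≠ p) :
    (W.quadraticTwist (e : ℚ)).HasAdditiveReductionAt ((primesEquiv (R := ℤ)).symm r) ↔
      (V.quadraticTwist (e : ℚ)).HasAdditiveReductionAt ((primesEquiv (R := ℤ)).symm r) := by
  have heQ : ((e : ℤ) : ℚ) ≠ 0 := by exact_mod_cast he
  haveI := W.isElliptic_quadraticTwist heQ
  haveI := V.isElliptic_quadraticTwist heQ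
  set v : HeightOneSpectrum ℤ := (primesEquiv (R := ℤ)).symm r with hv
  rw [← two_le_conductorExponent_iff_holds v (W.quadraticTwist (e : ℚ)),
    ← two_le_conductorExponent_iff_holds v (V.quadraticTwist (e : ℚ)), hv,
    ← factorization_conductorNorm_primesEquiv_symm (W.quadraticTwist (e : ℚ)) r,
    ← factorization_conductorNorm_primesEquiv_symm (V.quadraticTwist (e : ℚ)) r,
    factorization_conductorNorm_quadraticTwist_eq_of_partner V W p hCV hp2 he r hrp]

/-! ### §3 The engine's hypotheses for the partner -/

/-- **Twist type transports to the partner.** If every odd additive prime of `E` is of quadratic-twist type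
(`E^{(r*)}` not additive at `r`), then so is every odd additive prime of `V` (`C • V = E^{(p*)}`, `N_E = N_V p²`,
`p ∤ N_V`): an additive prime `r` of `V` is `≠ p`, `E` is additive there too, and `V^{(r*)} ≅_{ℚ_r}`-conductor-wise `E^{(r*)}`.
[cite: SilvermanAEC2009, X.5 Cor. 5.4 and App. C §16] -/
theorem twistType_of_partner (hNWV : W.conductorNorm ℤ = V.conductorNorm ℤ * p ^ 2) {CV : VariableChange ℚ}
    (hCV : CV • V = W.quadraticTwist ((-1 : ℚ) ^ (p / 2) * p)) (hp2 : p ≠ 2) (hpN : ¬ p ∣ V.conductorNorm ℤ)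
    (htt : ∀ r : Nat.Primes, (r : ℕ) ≠ 2 → W.HasAdditiveReductionAt ((primesEquiv (R := ℤ)).symm r) →
      ¬ (W.quadraticTwist (((-1 : ℤ) ^ ((r : ℕ) / 2) * r : ℤ) : ℚ)).HasAdditiveReductionAt
        ((primesEquiv (R := ℤ)).symm r)) :
    ∀ r : Nat.Primes, (r : ℕ) ≠ 2 → V.HasAdditiveReductionAt ((primesEquiv (R := ℤ)).symm r) →
      ¬ (V.quadraticTwist (((-1 : ℤ) ^ ((r : ℕ) / 2) * r : ℤ) : ℚ)).HasAdditiveReductionAt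
        ((primesEquiv (R := ℤ)).symm r) := by
  intro r hr2 haddV
  have hrp : (r : ℕ) ≠ p := by
    intro hrp
    apply not_hasAdditiveReductionAt_partner_at_p V p hpN
    have : (⟨p, hp.out⟩ : Nat.Primes) = r := Subtype.ext hrp.symm
    rw [this]
    exact haddV
  have haddW : W.HasAdditiveReductionAt ((primesEquiv (R := ℤ)).symm r) :=
    (hasAdditiveReductionAt_iff_of_partner V W p hNWV r hrp).mpr haddV
  have hrs0 : ((-1 : ℤ) ^ ((r : ℕ) / 2) * r : ℤ) ≠ 0 :=
    mul_ne_zero (pow_ne_zero _ (by norm_num)) (by exact_mod_cast r.2.ne_zero)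
  intro haddVt
  exact htt r hr2 haddW
    ((hasAdditiveReductionAt_quadraticTwist_iff_of_partner V W p hCV hp2 hrs0 r hrp).mpr haddVt)

/-- **The partner at the twisted Wan prime and at `2`.** For `(E, p)` with partner `V` (`C • V = E^{(p*)}`,
`N_E = N_V p²`), a twisted Wan prime `q` of `(E, p)` and `E` not additive at `2` (`p` odd): `V` is additive at `q`,
`V^{(q*)}` is multiplicative at `q`, and `V` is not additive at `2`. [cite: SilvermanATAEC1994, IV.10.2] -/
theorem partner_local_data [W.IsGloballyMinimal] (hNWV : W.conductorNorm ℤ = V.conductorNorm ℤ * p ^ 2)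
    {CV : VariableChange ℚ} (hCV : CV • V = W.quadraticTwist ((-1 : ℚ) ^ (p / 2) * p)) (hp2 : p ≠ 2)
    {q : ℕ} [hq : Fact q.Prime] (htw : TwistedWanPrime W p q)
    (h2 : ¬ W.HasAdditiveReductionAt ((primesEquiv (R := ℤ)).symm ⟨2, Nat.prime_two⟩)) :
    V.HasAdditiveReductionAt ((primesEquiv (R := ℤ)).symm ⟨q, hq.out⟩) ∧
      (V.quadraticTwist (((-1 : ℤ) ^ (q / 2) * q : ℤ) : ℚ)).HasMultiplicativeReductionAtPrime q ∧
      ¬ V.HasAdditiveReductionAt ((primesEquiv (R := ℤ)).symm ⟨2, Nat.prime_two⟩) := by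
  obtain ⟨hqp, -, haddq, hmultq, -⟩ := htw
  have hqs0 : ((-1 : ℤ) ^ (q / 2) * q : ℤ) ≠ 0 :=
    mul_ne_zero (pow_ne_zero _ (by norm_num)) (by exact_mod_cast hq.out.ne_zero)
  refine ⟨(hasAdditiveReductionAt_iff_of_partner V W p hNWV ⟨q, hq.out⟩ hqp).mp haddq, ?_, ?_⟩
  · rw [primeStar_eq] at hmultq
    exact (hasMultiplicativeReductionAtPrime_quadraticTwist_iff_of_partner V W p hCV hp2 hqs0 hqp).mp hmultq
  · exact fun h ↦ h2 ((hasAdditiveReductionAt_iff_of_partner V W p hNWV ⟨2, Nat.prime_two⟩ (Ne.symm hp2)).mpr h)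

end Summit.BirchSwinnertonDyer.BirchSwinnertonDyer.Theorems.TwistedWanRoad

end
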